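import Literature.NumberTheory.GaloisRepresentations.LubinTateComparisonDilation
import Literature.NumberTheory.EllipticCurves.PAdicOneVariableAffineStructure
import HarnessLib

/-!
# `p = 2`: the `𝒪_F`-action on Coleman series, transported by `ϑ` and read in the measure side's field, IS
# the dilation `binomDilate` — `(h ∘ [a]_{f'}) ∘ ϑ ↦ binomDilate (e a) (h ∘ ϑ)`, hence `D ↦ (e a)_* D`

Topic `NumberTheory/EllipticCurves`; namespace `Literature.NumberTheory.EllipticCurves`.

De Shalit, *Iwasawa theory of elliptic curves with complex multiplication* (1987), I.3.4 Lemma (ii) / II.4.5 (iv),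
II.4.6: `μ_{σβ}(σU) = μ_β(U)` because `g_{σβ} = g_β ∘ [κσ]_{f'}` and, on `Ĝ_m`, `[a] = (1+S)^a − 1` is the
dilation of measures.  The tree has the measure half (`binomDilate u H = H ∘ ((1+S)^u − 1)`,
`binomDilate_eq_subst`, `invAmice₁_binomDilate_μ : D_{binomDilate u H} = u_* D_H`, files
`PAdicOneVariableDilation/AffineStructure.lean`) and the θ-transport of the action over `𝒪̂_{F^nr}`
(`subst_compSeriesC_subst_homC'`, `map_hom_ltPoly_two_eq_binomialSeries_sub_one`, file
`LubinTateComparisonDilation.lean`).  This file joins them, for a local field `F` with `|𝓀_F| = 2`, `2` a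
uniformiser, `π' = 2u`, `ϑ = compSeriesC h2 hσ₀ u hε : Ĝ_m → F_{f'}`, ANY ring map `Θ : 𝒪̂_{F^nr} → 𝕜` into a
normed `ℚ_2`-algebra and ANY ring map `e : 𝒪[F] → ℤ_2` compatible with it (`Θ ∘ ι = padicIntCast ∘ e` on
`𝒪[F]`; for `F = ℚ_[2]`: `Θ = θ ∘ toC`, `e` = the identity `𝒪[ℚ_[2]] ≃ ℤ_[2]`):

* ★★ `map_subst_compSeriesC_subst_homC'_eq_binomDilate` — **`Θ((h ∘ [a]_{f'}) ∘ ϑ) = binomDilate (e a) (Θ(h ∘ ϑ))`**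
  for every `h ∈ 𝒪̂_{F^nr}⟦X⟧` and `a ∈ 𝒪[F]`;
* ★★ `invAmice₁_map_subst_homC'_μ` — hence, for `a` with `e a` a unit,
  **`D_{Θ((h∘[a]_{f'})∘ϑ)} = (e a)_* D_{Θ(h∘ϑ)}`** levelwise (tree `invAmice₁_binomDilate_μ`): the input
  `hν` of the U_0-equivariance `comap_family_equivariant` / `restrictUnits_density_unitInv_μ_of_μ_eq_mul_mulUnit`
  of the measure-side recipe (DIVISION-STEP §2(a)), from cf2c-w7's `g_{σβ} = g_β ∘ [κσ]` and
  `δ(g ∘ [a]) = a·(δg)∘[a]`.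

Everything is proved; no named facts, no definitions, no instances, no `sorry`.

## References

* [deShalit1987] E. de Shalit, *Iwasawa theory of elliptic curves with complex multiplication* (1987),
  I.3.4 Lemma (ii) (p. 18), II.4.5 (iv), II.4.6 (14) (p. 59).
-/

noncomputable section

open MvPowerSeries

namespace Literature.NumberTheory.EllipticCurves

section DilationOfComparison

open ValuativeRel IsLocalRing Field
open Literature.NumberTheory.GaloisRepresentations Literature.NumberTheory.GaloisRepresentations.IsNonarchimedeanLocalField
  Literature.NumberTheory.GaloisRepresentations.LubinTate Literature.NumberTheory.PAdicHodge

variable {F : Type} [Field F] [ValuativeRel F] [TopologicalSpace F] [IsNonarchimedeanLocalField F]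
variable (hq : residueFieldCard F = 2) (h2 : (valuation F).IsUniformizer (((2 : ℕ) : 𝒪[F]) : F))
  {σ₀ : absoluteGaloisGroup F} (hσ₀ : IsAbsArithFrob σ₀) (u : 𝒪[F]ˣ)
  {ε : (maxUnramifiedCompletion F)ˣ}
  (hε : maxUnramifiedCompletion.galAut F σ₀ (ε : maxUnramifiedCompletion F) =
    algebraMap 𝒪[F] (maxUnramifiedCompletion F) (u : 𝒪[F]) * (ε : maxUnramifiedCompletion F))
variable {𝕜 : Type*} [NormedField 𝕜] [NormedAlgebra ℚ_[2] 𝕜]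
  (Θ : UnrCoeff F →+* 𝕜) (e : 𝒪[F] →+* ℤ_[2]) (hΘe : ∀ a : 𝒪[F], Θ (intToUnrCoeff F a) = padicIntCast 𝕜 (e a))

include hq hΘe in
/-- `[a]_{f₀}` (`f₀ = 2X + X²`) read in `𝕜` through `Θ` is the inner series `(1+S)^{e a} − 1` of
`binomDilate (e a)`. [cite: deShalit1987, I.3.4 Lemma (ii) (p. 18)] -/
theorem map_homC_eq_map_binomialSeries_sub_one (a : 𝒪[F]) :
    (homC h2 a).map Θ = (PowerSeries.binomialSeries ℤ_[2] (e a)).map (padicIntCast 𝕜) - 1 := by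
  have hcomp : Θ.comp (intToUnrCoeff F) = (padicIntCast 𝕜).comp e := RingHom.ext hΘe
  rw [homC, ← RingHom.comp_apply (PowerSeries.map Θ) (PowerSeries.map (intToUnrCoeff F)),
    ← PowerSeries.map_comp, hcomp, PowerSeries.map_comp, RingHom.comp_apply,
    map_hom_ltPoly_two_eq_binomialSeries_sub_one hq h2 e a, map_sub, map_one]

include hq hΘe in
/-- ★★ **`Θ((h ∘ [a]_{f'}) ∘ ϑ) = binomDilate (e a) (Θ(h ∘ ϑ))`**: the `𝒪_F`-action on series for `F_{f'}`,
transported by `ϑ` and read in `𝕜`, is the dilation of the measure side.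
[cite: deShalit1987, I.3.4 Lemma (ii) (p. 18), II.4.6 (14) (p. 59)] -/
theorem map_subst_compSeriesC_subst_homC'_eq_binomDilate (a : 𝒪[F]) (h : PowerSeries (UnrCoeff F)) :
    (PowerSeries.subst (compSeriesC h2 hσ₀ u hε) (PowerSeries.subst (homC' h2 u a) h)).map Θ =
      binomDilate (e a) ((PowerSeries.subst (compSeriesC h2 hσ₀ u hε) h).map Θ) := by
  rw [subst_compSeriesC_subst_homC' h2 hσ₀ u hε a h,
    PowerSeries.map_subst (PowerSeries.HasSubst.of_constantCoeff_zero' (constantCoeff_homC h2 a)),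
    binomDilate_eq_subst]
  congr 1
  exact map_homC_eq_map_binomialSeries_sub_one hq h2 Θ e hΘe a

variable [IsUltrametricDist 𝕜] [CompleteSpace 𝕜]

include hq hΘe in
/-- ★★ **`D_{Θ((h ∘ [a]_{f'}) ∘ ϑ)} = (e a)_* D_{Θ(h ∘ ϑ)}`** levelwise, for `a ∈ 𝒪[F]` with `e a` a unit
(tree `invAmice₁_binomDilate_μ`: `D_{H ∘ [u]} = u_* D_H`): de Shalit's `μ_{σβ}(σU) = μ_β(U)` on the `ℤ_p`
side — the input `hν` of the U_0-equivariance of the measure-side recipe.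
[cite: deShalit1987, I.3.4 Lemma (ii) (p. 18), II.4.6 (14) (p. 59)] -/
theorem invAmice₁_map_subst_homC'_μ (a : 𝒪[F]) (v : ℤ_[2]ˣ) (hv : (v : ℤ_[2]) = e a)
    (h : PowerSeries (UnrCoeff F)) {C : ℝ}
    (hC : ∀ k, ‖PowerSeries.coeff k ((PowerSeries.subst (compSeriesC h2 hσ₀ u hε) h).map Θ)‖ ≤ C)
    (hC' : ∀ k, ‖PowerSeries.coeff k
      ((PowerSeries.subst (compSeriesC h2 hσ₀ u hε) (PowerSeries.subst (homC' h2 u a) h)).map Θ)‖ ≤ C)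
    (n : ℕ) (c : ZMod (2 ^ n)) :
    (invAmice₁ 2 ((PowerSeries.subst (compSeriesC h2 hσ₀ u hε) (PowerSeries.subst (homC' h2 u a) h)).map Θ)
        hC').μ n c =
      ((invAmice₁ 2 ((PowerSeries.subst (compSeriesC h2 hσ₀ u hε) h).map Θ) hC).mulUnit v).μ n c := by
  have key := map_subst_compSeriesC_subst_homC'_eq_binomDilate hq h2 hσ₀ u hε Θ e hΘe a h
  rw [← hv] at key
  rw [← invAmice₁_binomDilate_μ hC v n c, invAmice₁_μ, invAmice₁_μ, key]

end DilationOfComparison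

end Literature.NumberTheory.EllipticCurves

end
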